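import Summits.MatrixMultiplication.MatrixMultiplication.Theorems.FarEdgeDescentImprovableRate
import HarnessLib

/-!
# Far-edge descent, kernel XXXV-A: the MOMENT (mean-field) readout of an improvable tower

Route `FarEdgeDescent`, special leaf `FiniteSaturation` (stmt-MatrixMultiplication-23739): helper
kernel, THESES-FREE and def-free (decomp-mm lens 2 «structural dichotomy: special vs generic», gen 55).

THE NEW READOUT.  Every rate proof of the lineage (kernels XXIX–XXXIV) reads the virtual readout
`G_j(s,t) ≤ r_j` of the squaring tower through the DEVIATION DYNAMICS of `γ_j = G_j/r_j` (a Riccati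
recursion `γ' = (θ+γ)² − θ²` tracked against the legs ratio `m_j`, kernel XXXI-A).  Here the same
readout is read through the FIRST MOMENTS of the virtual polynomial instead.  `G_j(s,t)` is a positive
combination of exponentials `w·exp((s−1)α − (1−t)β)` of total weight `L_j = G_j(1,1)`; write
`M_j = Σ wα` (the `s`-moment, «leg mass») and `N_j = Σ wβ` (the `t`-moment, «anchor mass»).  Jensen's
inequality for `exp` (the mean field) gives the tangent plane of `log G_j` at the corner `(1,1)`:
  `G_j(s,t) ≥ L_j · exp( ((s−1)M_j − (1−t)N_j) / L_j )`            (`moment_invariant`),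
and the moments obey the LINEAR recursion `L' = L² + 2QL`, `M' = 2(L+Q)M`,
`N' = 2(L+Q)N + 2QL·log Q` — proved here by induction from the chain recursion alone, the step being
the two-term AM–GM `A eˣ + B eʸ ≥ (A+B)e^{(Ax+By)/(A+B)}` (`meanField_two`); no expansion of `G_j` into
words is needed.  The readout then becomes a family of LINE CERTIFICATES through the corner,
  `(s−1)·M_j ≤ (1−t)·N_j + L_j·log(r_j/L_j)`                        (`moment_certificate`),
with slope (ASPECT) `k_j = N_j/M_j` and intercept `c_j = L_j log(r_j/L_j)/M_j`.  Two Lyapunov exponents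
decide everything: `M_j/r_j` grows by `2(1−m_j) ≥ 4/3` per squaring (`moment_s_ge`) while
`N_j ≤ r_j log r_j` doubles (`moment_t_le`), so `c_j ≲ (3/4)^j` and `k_j ≲ (3/2)^j`; optimising the
stage against `1−t` (`wedge_of_dyadicEnvelope`, `2^j ≈ 1/(1−t)`) yields the wedge
`s − 1 ≤ C(1−t)^κ`, `κ = log₂(4/3)` (`virtualPowerBound_of_momentChain`) and, by the Legendre conversion
of kernel XXVII, `RateBeyond θ` for every `θ < κ/(1−κ) = log(4/3)/log(3/2) = θ_S = 0.70951…`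
(`rateBeyond_of_momentChain`).  STRUCTURAL READING of `θ_S`: it is the ratio of the two exponents,
`log(intercept decay 4/3) / log(aspect growth 3/2)`.  DICHOTOMY (kernel XXXV-B): `FiniteSaturation`
holds iff some certificate family has BOUNDED aspect («fat» leg mass); the `E₃` tower is «thin»
(`k_j → ∞`), which is why its ladder stops at `θ_S`.
Interface theorem only: the chain `(r,Q,L,G)` is supplied by kernel XXXII-C (`isolatedTowerChain`);
nothing here asserts its existence.

References: Schönhage 1981 §5 (the `E₃` example); Pan 1984 (LNCS 179) §16 Props. 16.2–16.5, §17
Thm. 17.1; Stothers 2010 Thm. 8; Knuth TAOCP 2 §4.6.4 Ex. 67(g); Lotti–Romani 1983 §2, Prop. 4.1;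
Coppersmith–Winograd 1982 §3.
Tags: `FiniteSaturation` (h₁) NEC · WEAKER-CONDITIONAL (rate `θ_S⁻` modulo the chain; unconditional in XXXV-B).
-/

set_option linter.dupNamespace false

noncomputable section

open scoped BigOperators

namespace Summit.MatrixMultiplication.MatrixMultiplication.Theorems.FarEdgeDescentMomentReadout

open Literature.Computability.AlgebraicComplexity
open Summit.MatrixMultiplication.MatrixMultiplication.Theorems.FarEdgeDescentImprovableDynamics
open Summit.MatrixMultiplication.MatrixMultiplication.Theorems.FarEdgeDescentImprovableRate

variable (K : Type) [Field K]

/-! ## §1 The mean field -/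

/-- **Two-term weighted AM–GM in exponential form** (Jensen for `exp`):
`(A+B)·exp((Ax+By)/(A+B)) ≤ A·eˣ + B·eʸ` for `A, B ≥ 0`, `A+B > 0`. [folklore] -/
theorem meanField_two {A B x y : ℝ} (hA : 0 ≤ A) (hB : 0 ≤ B) (hAB : 0 < A + B) :
    (A + B) * Real.exp ((A * x + B * y) / (A + B)) ≤ A * Real.exp x + B * Real.exp y := by
  have hne : A + B ≠ 0 := hAB.ne'
  have h := convexOn_exp.2 (Set.mem_univ x) (Set.mem_univ y) (div_nonneg hA hAB.le)
    (div_nonneg hB hAB.le) (by field_simp)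
  simp only [smul_eq_mul] at h
  have e : A / (A + B) * x + B / (A + B) * y = (A * x + B * y) / (A + B) := by
    field_simp
  rw [e] at h
  have h2 := mul_le_mul_of_nonneg_left h hAB.le
  have e2 : (A + B) * (A / (A + B) * Real.exp x + B / (A + B) * Real.exp y) =
      A * Real.exp x + B * Real.exp y := by
    field_simp
  linarith [e2]

/-- **Dyadic envelope ⟹ power wedge.**  If `σ·(4/3)^n ≤ B·(τ 2^n) + A` for every `n : ℕ`
(`A, B ≥ 0`, `0 ≤ τ ≤ 1`), then `σ ≤ (4/3)(A+B)·τ^{log₂(4/3)}` (take `2^n ≈ 1/τ`). [folklore] -/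
theorem wedge_of_dyadicEnvelope {σ τ A B : ℝ} (hA : 0 ≤ A) (hB : 0 ≤ B) (hτ0 : 0 ≤ τ)
    (hτ1 : τ ≤ 1) (h : ∀ n : ℕ, σ * ((4 : ℝ) / 3) ^ n ≤ B * (τ * 2 ^ n) + A) :
    σ ≤ 4 / 3 * (A + B) * τ ^ Real.logb 2 ((4 : ℝ) / 3) := by
  obtain ⟨hκ0, -⟩ := improvableKappa_pos_lt_one
  rcases hτ0.eq_or_lt with h0 | hτpos
  · rw [← h0, Real.zero_rpow hκ0.ne', mul_zero]
    by_contra hσ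
    push Not at hσ
    obtain ⟨n, hn⟩ := pow_unbounded_of_one_lt ((A + 1) / σ) (by norm_num : (1 : ℝ) < 4 / 3)
    have h1 : σ * ((4 : ℝ) / 3) ^ n ≤ A := by simpa [← h0] using h n
    have e : (A + 1) / σ * σ = A + 1 := div_mul_cancel₀ _ hσ.ne'
    nlinarith [mul_lt_mul_of_pos_right hn hσ]
  · obtain ⟨n, hn1, hn2⟩ :=
      exists_nat_pow_near ((one_le_inv₀ hτpos).2 hτ1) (by norm_num : (1 : ℝ) < 2)
    have hτ2 : τ * 2 ^ n ≤ 1 := by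
      calc τ * 2 ^ n ≤ τ * τ⁻¹ := mul_le_mul_of_nonneg_left hn1 hτpos.le
        _ = 1 := mul_inv_cancel₀ hτpos.ne'
    have h1 : σ * ((4 : ℝ) / 3) ^ n ≤ A + B := by
      nlinarith [h n, mul_le_mul_of_nonneg_left hτ2 hB]
    have h43pos : (0 : ℝ) < ((4 : ℝ) / 3) ^ n := by positivity
    have hlt : ((2 : ℝ) ^ (n + 1))⁻¹ < τ := (inv_lt_comm₀ hτpos (by positivity)).1 hn2
    have h3 : (((2 : ℝ) ^ (n + 1))⁻¹) ^ Real.logb 2 ((4 : ℝ) / 3) ≤ τ ^ Real.logb 2 ((4 : ℝ) / 3) :=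
      Real.rpow_le_rpow (by positivity) hlt.le hκ0.le
    have e : (((2 : ℝ) ^ (n + 1))⁻¹) ^ Real.logb 2 ((4 : ℝ) / 3) = (((4 : ℝ) / 3) ^ (n + 1))⁻¹ := by
      rw [Real.inv_rpow (by positivity), ← Real.rpow_pow_comm (by norm_num),
        Real.rpow_logb (by norm_num) (by norm_num) (by norm_num)]
    rw [e] at h3
    have h4 : σ ≤ (A + B) / ((4 : ℝ) / 3) ^ n := by rw [le_div_iff₀ h43pos]; exact h1
    have h5 : (A + B) / ((4 : ℝ) / 3) ^ n = 4 / 3 * (A + B) * (((4 : ℝ) / 3) ^ (n + 1))⁻¹ := by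
      rw [pow_succ]
      field_simp
    rw [h5] at h4
    exact le_trans h4 (mul_le_mul_of_nonneg_left h3 (by positivity))

/-! ## §2 The moments of an improvable chain -/

section Chain

variable (r Q L : ℕ → ℕ) (G : ℕ → ℝ → ℝ → ℝ) (M N : ℕ → ℝ)

/-- Real form of the legs recursion: `L' = L² + 2QL`. [folklore] -/
theorem legs_real (hL : ∀ j, L (j + 1) = (Q j + L j) ^ 2 - Q j ^ 2) (j : ℕ) :
    (L (j + 1) : ℝ) = (L j : ℝ) ^ 2 + 2 * (Q j : ℝ) * L j := by
  have hle : Q j ^ 2 ≤ (Q j + L j) ^ 2 := Nat.pow_le_pow_left (by omega) 2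
  rw [hL j]
  push_cast [Nat.cast_sub hle]
  ring

/-- `L_j ≥ 1` throughout if `L₀ ≥ 1`. [folklore] -/
theorem one_le_legs (hL : ∀ j, L (j + 1) = (Q j + L j) ^ 2 - Q j ^ 2) (hL0 : 1 ≤ L 0) :
    ∀ j, (1 : ℝ) ≤ L j := by
  intro j
  induction j with
  | zero => exact_mod_cast hL0
  | succ j ih =>
    rw [legs_real Q L hL j]
    have hQ : (0 : ℝ) ≤ Q j := Nat.cast_nonneg _
    nlinarith

/-- **MOMENT INVARIANT (mean-field tangent plane).**  If the moments `M, N` follow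
`M' = 2(L+Q)M`, `N' = 2(L+Q)N + 2QL·log Q` and the initial virtual polynomial dominates its mean field,
then at every stage and every real `(s,t)`:
`G_j(s,t) ≥ L_j · exp(((s−1)M_j − (1−t)N_j)/L_j)`.  The step is `meanField_two` applied to
`G' = G² + 2Q^t G ≥ L²e^{2u} + 2QL·e^{u−(1−t)log Q}`. [cite: Pan1984, Props. 16.2–16.5]
[cite: Stothers2010, Thm. 8] -/
theorem moment_invariant (hQ1 : ∀ j, 1 ≤ Q j)
    (hL : ∀ j, L (j + 1) = (Q j + L j) ^ 2 - Q j ^ 2) (hL0 : 1 ≤ L 0)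
    (hG : ∀ j (s t : ℝ), G (j + 1) s t = (((Q j : ℕ) : ℝ) ^ t + G j s t) ^ 2 - (((Q j : ℕ) : ℝ) ^ t) ^ 2)
    (hM : ∀ j, M (j + 1) = 2 * ((L j : ℝ) + Q j) * M j)
    (hN : ∀ j, N (j + 1) = 2 * ((L j : ℝ) + Q j) * N j + 2 * (Q j : ℝ) * L j * Real.log (Q j))
    (hI0 : ∀ s t : ℝ, (L 0 : ℝ) * Real.exp (((s - 1) * M 0 - (1 - t) * N 0) / L 0) ≤ G 0 s t) :
    ∀ j (s t : ℝ), (L j : ℝ) * Real.exp (((s - 1) * M j - (1 - t) * N j) / L j) ≤ G j s t := by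
  intro j
  induction j with
  | zero => exact hI0
  | succ j ih =>
    intro s t
    have hLj : (1 : ℝ) ≤ L j := one_le_legs Q L hL hL0 j
    have hQj : (1 : ℝ) ≤ Q j := by exact_mod_cast hQ1 j
    have hLpos : (0 : ℝ) < L j := by linarith
    have hQpos : (0 : ℝ) < Q j := by linarith
    obtain ⟨u, hu⟩ : ∃ u : ℝ, u = ((s - 1) * M j - (1 - t) * N j) / L j := ⟨_, rfl⟩
    have ihu := ih s t
    rw [← hu] at ihu
    have hEpos : 0 < (L j : ℝ) * Real.exp u := by positivity
    have hQt : ((Q j : ℕ) : ℝ) ^ t = (Q j : ℝ) * Real.exp (-((1 - t) * Real.log (Q j))) := by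
      calc ((Q j : ℕ) : ℝ) ^ t = Real.exp (Real.log (Q j) * t) := Real.rpow_def_of_pos hQpos t
        _ = Real.exp (Real.log (Q j)) * Real.exp (-((1 - t) * Real.log (Q j))) := by
            rw [← Real.exp_add]; congr 1; ring
        _ = (Q j : ℝ) * Real.exp (-((1 - t) * Real.log (Q j))) := by rw [Real.exp_log hQpos]
    have hL' : (L (j + 1) : ℝ) = (L j : ℝ) ^ 2 + 2 * (Q j : ℝ) * L j := legs_real Q L hL j
    have hL'pos : (0 : ℝ) < (L j : ℝ) ^ 2 + 2 * (Q j : ℝ) * L j := by positivity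
    have hmf := meanField_two (x := 2 * u) (y := u - (1 - t) * Real.log (Q j))
      (sq_nonneg (L j : ℝ)) (by positivity : (0 : ℝ) ≤ 2 * (Q j : ℝ) * L j) hL'pos
    have hexp : ((L j : ℝ) ^ 2 * (2 * u) + 2 * (Q j : ℝ) * L j * (u - (1 - t) * Real.log (Q j))) /
        ((L j : ℝ) ^ 2 + 2 * (Q j : ℝ) * L j) =
        ((s - 1) * M (j + 1) - (1 - t) * N (j + 1)) / L (j + 1) := by
      rw [hL', hM j, hN j, hu]
      field_simp
      ring
    have hsq : ((L j : ℝ) * Real.exp u) ^ 2 = (L j : ℝ) ^ 2 * Real.exp (2 * u) := by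
      rw [mul_pow, sq (Real.exp u), ← Real.exp_add, show u + u = 2 * u by ring]
    have hcross : ((Q j : ℕ) : ℝ) ^ t * ((L j : ℝ) * Real.exp u) =
        (Q j : ℝ) * L j * Real.exp (u - (1 - t) * Real.log (Q j)) := by
      rw [hQt, sub_eq_add_neg u, Real.exp_add]
      ring
    have hlow : (L j : ℝ) ^ 2 * Real.exp (2 * u) +
        2 * (Q j : ℝ) * L j * Real.exp (u - (1 - t) * Real.log (Q j)) ≤ G (j + 1) s t := by
      rw [hG j s t]
      have h1 : ((L j : ℝ) * Real.exp u) ^ 2 ≤ (G j s t) ^ 2 := pow_le_pow_left₀ hEpos.le ihu 2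
      have h2 : ((Q j : ℕ) : ℝ) ^ t * ((L j : ℝ) * Real.exp u) ≤ ((Q j : ℕ) : ℝ) ^ t * G j s t :=
        mul_le_mul_of_nonneg_left ihu (Real.rpow_nonneg hQpos.le t)
      rw [hsq] at h1
      rw [hcross] at h2
      nlinarith [h1, h2]
    calc (L (j + 1) : ℝ) * Real.exp (((s - 1) * M (j + 1) - (1 - t) * N (j + 1)) / L (j + 1))
        = ((L j : ℝ) ^ 2 + 2 * (Q j : ℝ) * L j) * Real.exp (((L j : ℝ) ^ 2 * (2 * u) +
            2 * (Q j : ℝ) * L j * (u - (1 - t) * Real.log (Q j))) /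
            ((L j : ℝ) ^ 2 + 2 * (Q j : ℝ) * L j)) := by rw [hexp, hL']
      _ ≤ (L j : ℝ) ^ 2 * Real.exp (2 * u) +
            2 * (Q j : ℝ) * L j * Real.exp (u - (1 - t) * Real.log (Q j)) := hmf
      _ ≤ G (j + 1) s t := hlow

/-- **LINE CERTIFICATE at stage `j`.**  On every sub-tangent `(s,t)` of `y ↦ ω(1,y,1)` the readout
`G_j ≤ r_j` and the moment invariant give the supporting-line inequality through the corner `(1,1)`:
`(s−1)·M_j − (1−t)·N_j ≤ L_j·log(r_j/L_j)` — slope `N_j/M_j`, intercept `L_j log(r_j/L_j)/M_j`.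
[cite: Schonhage1981, §5] [cite: Pan1984, Thm. 17.1] [cite: LottiRomani1983, Prop. 4.1] -/
theorem moment_certificate (hQ1 : ∀ j, 1 ≤ Q j)
    (hL : ∀ j, L (j + 1) = (Q j + L j) ^ 2 - Q j ^ 2) (hL0 : 1 ≤ L 0)
    (hG : ∀ j (s t : ℝ), G (j + 1) s t = (((Q j : ℕ) : ℝ) ^ t + G j s t) ^ 2 - (((Q j : ℕ) : ℝ) ^ t) ^ 2)
    (hread : ∀ j (s t : ℝ), (∀ y : ℝ, 0 ≤ y → s + y * t ≤ omegaRect K 1 y 1) → G j s t ≤ r j)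
    (hM : ∀ j, M (j + 1) = 2 * ((L j : ℝ) + Q j) * M j)
    (hN : ∀ j, N (j + 1) = 2 * ((L j : ℝ) + Q j) * N j + 2 * (Q j : ℝ) * L j * Real.log (Q j))
    (hI0 : ∀ s t : ℝ, (L 0 : ℝ) * Real.exp (((s - 1) * M 0 - (1 - t) * N 0) / L 0) ≤ G 0 s t)
    (j : ℕ) {s t : ℝ} (hst : ∀ y : ℝ, 0 ≤ y → s + y * t ≤ omegaRect K 1 y 1) :
    (s - 1) * M j - (1 - t) * N j ≤ (L j : ℝ) * Real.log ((r j : ℝ) / L j) := by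
  have hLj : (1 : ℝ) ≤ L j := one_le_legs Q L hL hL0 j
  have hLpos : (0 : ℝ) < L j := by linarith
  have h := le_trans (moment_invariant Q L G M N hQ1 hL hL0 hG hM hN hI0 j s t) (hread j s t hst)
  have hEpos : 0 < (L j : ℝ) * Real.exp (((s - 1) * M j - (1 - t) * N j) / L j) := by positivity
  have hrpos : (0 : ℝ) < r j := lt_of_lt_of_le hEpos h
  have h2 : Real.exp (((s - 1) * M j - (1 - t) * N j) / L j) ≤ (r j : ℝ) / L j := by
    rw [le_div_iff₀ hLpos]
    linarith
  have h3 : ((s - 1) * M j - (1 - t) * N j) / L j ≤ Real.log ((r j : ℝ) / L j) := by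
    rw [← Real.exp_le_exp, Real.exp_log (by positivity)]
    exact h2
  rw [div_le_iff₀ hLpos] at h3
  linarith

/-- **The `t`-moment at most doubles:** `N_j ≤ r_j·log r_j` (`= 2^j r_j log r₀`), since
`N' = 2(L+Q)N + 2QL log Q ≤ 2 log r·((L+Q)r + QL) ≤ 2r² log r` for `r = Q + 2L`. [folklore] -/
theorem moment_t_le (hsum : ∀ j, Q j + 2 * L j = r j) (hQ1 : ∀ j, 1 ≤ Q j)
    (hr : ∀ j, r (j + 1) = r j ^ 2)
    (hN : ∀ j, N (j + 1) = 2 * ((L j : ℝ) + Q j) * N j + 2 * (Q j : ℝ) * L j * Real.log (Q j))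
    (hN0 : N 0 ≤ (r 0 : ℝ) * Real.log (r 0)) : ∀ j, N j ≤ (r j : ℝ) * Real.log (r j) := by
  intro j
  induction j with
  | zero => exact hN0
  | succ j ih =>
    have hsumR : (Q j : ℝ) + 2 * L j = r j := by exact_mod_cast hsum j
    have hQj : (1 : ℝ) ≤ Q j := by exact_mod_cast hQ1 j
    have hL0' : (0 : ℝ) ≤ L j := Nat.cast_nonneg _
    have hQr : (Q j : ℝ) ≤ r j := by linarith
    have hlogQ : Real.log (Q j) ≤ Real.log (r j) := Real.log_le_log (by linarith) hQr
    have hlog0 : 0 ≤ Real.log (r j) := Real.log_nonneg (le_trans hQj hQr)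
    have hrR : (r (j + 1) : ℝ) = (r j : ℝ) ^ 2 := by rw [hr j]; push_cast; ring
    rw [hN j, hrR, Real.log_pow]
    push_cast
    have h1 : 2 * ((L j : ℝ) + Q j) * N j ≤ 2 * ((L j : ℝ) + Q j) * (r j * Real.log (r j)) :=
      mul_le_mul_of_nonneg_left ih (by positivity)
    have h2 : 2 * (Q j : ℝ) * L j * Real.log (Q j) ≤ 2 * (Q j : ℝ) * L j * Real.log (r j) :=
      mul_le_mul_of_nonneg_left hlogQ (by positivity)
    have h3 : (((L j : ℝ) + Q j) * r j + Q j * L j) * Real.log (r j) ≤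
        (r j : ℝ) ^ 2 * Real.log (r j) := by
      apply mul_le_mul_of_nonneg_right _ hlog0
      rw [← hsumR]
      nlinarith
    nlinarith [h1, h2, h3]

/-- **The `s`-moment grows by `≥ 4/3` per squaring:** `M_j ≥ (4/3)^j·(M₀/r₀)·r_j`, since
`M' = 2(L+Q)M = 2(r−L)M ≥ (4/3)rM` by `3L ≤ r` («the anchor is a third»). [cite: Pan1984, Prop. 16.5]
[cite: Stothers2010, Thm. 8] -/
theorem moment_s_ge (hsum : ∀ j, Q j + 2 * L j = r j) (hQ1 : ∀ j, 1 ≤ Q j)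
    (hm0 : 3 * L 0 ≤ r 0) (hL : ∀ j, L (j + 1) = (Q j + L j) ^ 2 - Q j ^ 2)
    (hr : ∀ j, r (j + 1) = r j ^ 2)
    (hM : ∀ j, M (j + 1) = 2 * ((L j : ℝ) + Q j) * M j) (hM0 : 0 ≤ M 0) :
    ∀ j, ((4 : ℝ) / 3) ^ j * (M 0 / r 0) * r j ≤ M j := by
  intro j
  induction j with
  | zero =>
    obtain ⟨hr0, -⟩ := improvable_normalForm r Q L hsum hQ1 hm0 hL hr 0
    rw [pow_zero, one_mul, div_mul_cancel₀ _ hr0.ne']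
  | succ j ih =>
    obtain ⟨hrpos, -, hm3, -, -⟩ := improvable_normalForm r Q L hsum hQ1 hm0 hL hr j
    have hsumR : (Q j : ℝ) + 2 * L j = r j := by exact_mod_cast hsum j
    have h3L : 3 * (L j : ℝ) ≤ r j := by rw [div_le_iff₀ hrpos] at hm3; linarith
    have hrR : (r (j + 1) : ℝ) = (r j : ℝ) ^ 2 := by rw [hr j]; push_cast; ring
    have hc : 0 ≤ ((4 : ℝ) / 3) ^ j * (M 0 / r 0) * r j :=
      mul_nonneg (mul_nonneg (pow_nonneg (by norm_num) _)
        (div_nonneg hM0 (Nat.cast_nonneg _))) (Nat.cast_nonneg _)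
    have hLQ : 4 / 3 * (r j : ℝ) ≤ 2 * ((L j : ℝ) + Q j) := by linarith
    rw [hM j, hrR]
    calc ((4 : ℝ) / 3) ^ (j + 1) * (M 0 / r 0) * ((r j : ℝ) ^ 2)
        = (4 / 3 * (r j : ℝ)) * (((4 : ℝ) / 3) ^ j * (M 0 / r 0) * r j) := by ring
      _ ≤ (2 * ((L j : ℝ) + Q j)) * M j := mul_le_mul hLQ ih hc (by positivity)

/-- **Stage envelope.**  On a sub-tangent `(s,t)` with `t ≤ 1`, for every stage `j`:
`(s−1)·(4/3)^j·(M₀/r₀) ≤ log r₀·((1−t)2^j) + 1` — the line certificate with `L log(r/L) ≤ r`,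
`N_j ≤ 2^j r_j log r₀`, `M_j ≥ (4/3)^j (M₀/r₀) r_j`. [cite: Pan1984, Thm. 17.1] [cite: Stothers2010, Thm. 8] -/
theorem stage_envelope (hsum : ∀ j, Q j + 2 * L j = r j) (hQ1 : ∀ j, 1 ≤ Q j)
    (hm0 : 3 * L 0 ≤ r 0) (hL : ∀ j, L (j + 1) = (Q j + L j) ^ 2 - Q j ^ 2) (hL0 : 1 ≤ L 0)
    (hr : ∀ j, r (j + 1) = r j ^ 2)
    (hG : ∀ j (s t : ℝ), G (j + 1) s t = (((Q j : ℕ) : ℝ) ^ t + G j s t) ^ 2 - (((Q j : ℕ) : ℝ) ^ t) ^ 2)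
    (hread : ∀ j (s t : ℝ), (∀ y : ℝ, 0 ≤ y → s + y * t ≤ omegaRect K 1 y 1) → G j s t ≤ r j)
    (hM : ∀ j, M (j + 1) = 2 * ((L j : ℝ) + Q j) * M j)
    (hN : ∀ j, N (j + 1) = 2 * ((L j : ℝ) + Q j) * N j + 2 * (Q j : ℝ) * L j * Real.log (Q j))
    (hM0 : 0 < M 0) (hN0 : N 0 ≤ (r 0 : ℝ) * Real.log (r 0))
    (hI0 : ∀ s t : ℝ, (L 0 : ℝ) * Real.exp (((s - 1) * M 0 - (1 - t) * N 0) / L 0) ≤ G 0 s t)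
    {s t : ℝ} (ht1 : t ≤ 1) (hst : ∀ y : ℝ, 0 ≤ y → s + y * t ≤ omegaRect K 1 y 1) (j : ℕ) :
    (s - 1) * (((4 : ℝ) / 3) ^ j * (M 0 / r 0)) ≤ Real.log (r 0) * ((1 - t) * 2 ^ j) + 1 := by
  have hcert := moment_certificate K r Q L G M N hQ1 hL hL0 hG hread hM hN hI0 j hst
  obtain ⟨hrpos, -, -, -, -⟩ := improvable_normalForm r Q L hsum hQ1 hm0 hL hr j
  have hLj : (1 : ℝ) ≤ L j := one_le_legs Q L hL hL0 j
  have hLpos : (0 : ℝ) < L j := by linarith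
  have hℓ : 0 ≤ Real.log (r 0) := Real.log_natCast_nonneg _
  have hlog : (L j : ℝ) * Real.log ((r j : ℝ) / L j) ≤ r j := by
    have h1 := Real.log_le_sub_one_of_pos (show 0 < (r j : ℝ) / L j by positivity)
    have h2 := mul_le_mul_of_nonneg_left h1 hLpos.le
    have e : (L j : ℝ) * ((r j : ℝ) / L j - 1) = r j - L j := by field_simp
    linarith
  have hNj := moment_t_le r Q L N hsum hQ1 hr hN hN0 j
  have hlogr : Real.log (r j) = 2 ^ j * Real.log (r 0) := by
    rw [r_eq_pow r hr j]
    push_cast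
    rw [Real.log_pow]
    push_cast
    ring
  have hMj := moment_s_ge r Q L M hsum hQ1 hm0 hL hr hM hM0.le j
  have h1 : (s - 1) * M j ≤ (r j : ℝ) * (Real.log (r 0) * ((1 - t) * 2 ^ j) + 1) := by
    have h := mul_le_mul_of_nonneg_left hNj (sub_nonneg.2 ht1)
    rw [hlogr] at h
    nlinarith [hcert, hlog, h]
  by_cases hs : 0 ≤ s - 1
  · have h2 := mul_le_mul_of_nonneg_left hMj hs
    have key : (s - 1) * (((4 : ℝ) / 3) ^ j * (M 0 / r 0)) * r j ≤
        (Real.log (r 0) * ((1 - t) * 2 ^ j) + 1) * r j := by nlinarith [h1, h2]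
    exact le_of_mul_le_mul_right key hrpos
  · push Not at hs
    have h2 : (s - 1) * (((4 : ℝ) / 3) ^ j * (M 0 / r 0)) ≤ 0 :=
      mul_nonpos_of_nonpos_of_nonneg hs.le (by positivity)
    have h3 : 0 ≤ Real.log (r 0) * ((1 - t) * 2 ^ j) + 1 := by
      have : 0 ≤ (1 - t) * 2 ^ j := mul_nonneg (sub_nonneg.2 ht1) (by positivity)
      nlinarith
    linarith

/-- **WEDGE FROM THE MOMENT READOUT.**  Under the moment-chain hypotheses every sub-tangent
`(s,t) ∈ [1,2]×[0,1]` of `ω(1,·,1)` satisfies `s − 1 ≤ C·(1−t)^κ`, `κ = log₂(4/3)`, with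
`C = (4/3)(r₀/M₀)(1 + log r₀)` (`E₃`: `r₀ = 10`, `M₀ = 3 log 3`, `C ≈ 13.4`).
[cite: Pan1984, Thm. 17.1] [cite: Stothers2010, Thm. 8] [cite: LottiRomani1983, Prop. 4.1] -/
theorem virtualPowerBound_of_momentChain (hsum : ∀ j, Q j + 2 * L j = r j) (hQ1 : ∀ j, 1 ≤ Q j)
    (hm0 : 3 * L 0 ≤ r 0) (hL : ∀ j, L (j + 1) = (Q j + L j) ^ 2 - Q j ^ 2) (hL0 : 1 ≤ L 0)
    (hr : ∀ j, r (j + 1) = r j ^ 2)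
    (hG : ∀ j (s t : ℝ), G (j + 1) s t = (((Q j : ℕ) : ℝ) ^ t + G j s t) ^ 2 - (((Q j : ℕ) : ℝ) ^ t) ^ 2)
    (hread : ∀ j (s t : ℝ), (∀ y : ℝ, 0 ≤ y → s + y * t ≤ omegaRect K 1 y 1) → G j s t ≤ r j)
    (hM : ∀ j, M (j + 1) = 2 * ((L j : ℝ) + Q j) * M j)
    (hN : ∀ j, N (j + 1) = 2 * ((L j : ℝ) + Q j) * N j + 2 * (Q j : ℝ) * L j * Real.log (Q j))
    (hM0 : 0 < M 0) (hN0 : N 0 ≤ (r 0 : ℝ) * Real.log (r 0))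
    (hI0 : ∀ s t : ℝ, (L 0 : ℝ) * Real.exp (((s - 1) * M 0 - (1 - t) * N 0) / L 0) ≤ G 0 s t) :
    ∃ C : ℝ, 0 ≤ C ∧ ∀ s t : ℝ, 0 ≤ t → t ≤ 1 → 1 ≤ s → s ≤ 2 →
      (∀ y : ℝ, 0 ≤ y → s + y * t ≤ omegaRect K 1 y 1) →
      s - 1 ≤ C * (1 - t) ^ Real.logb 2 ((4 : ℝ) / 3) := by
  have hr0pos : (0 : ℝ) < r 0 := (improvable_normalForm r Q L hsum hQ1 hm0 hL hr 0).1
  have hℓ : 0 ≤ Real.log (r 0) := Real.log_natCast_nonneg _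
  have hμ : 0 < M 0 / r 0 := div_pos hM0 hr0pos
  refine ⟨4 / 3 * (1 / (M 0 / r 0) + Real.log (r 0) / (M 0 / r 0)), by positivity,
    fun s t ht0 ht1 _ _ hst => ?_⟩
  have env : ∀ n : ℕ, (s - 1) * ((4 : ℝ) / 3) ^ n ≤
      Real.log (r 0) / (M 0 / r 0) * ((1 - t) * 2 ^ n) + 1 / (M 0 / r 0) := by
    intro n
    have h := stage_envelope K r Q L G M N hsum hQ1 hm0 hL hL0 hr hG hread hM hN hM0 hN0 hI0
      ht1 hst n
    rw [div_mul_eq_mul_div, ← add_div, le_div_iff₀ hμ]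
    linarith
  exact wedge_of_dyadicEnvelope (by positivity) (by positivity) (sub_nonneg.2 ht1) (by linarith) env

/-- **RATE `θ_S⁻` FROM THE MOMENT READOUT.**  Under the moment-chain hypotheses:
`RateBeyond θ` (spelled) for every `θ < κ/(1−κ) = log(4/3)/log(3/2) = 0.70951…`, `κ = log₂(4/3)` —
the order of record of the isolated tower, re-derived from three numbers per stage `(L_j, M_j, N_j)`
instead of the deviation dynamics. [cite: Pan1984, Thm. 17.1] [cite: Stothers2010, Thm. 8]
[cite: LottiRomani1983, §2 (p. 174), Prop. 4.1] -/
theorem rateBeyond_of_momentChain (hsum : ∀ j, Q j + 2 * L j = r j) (hQ1 : ∀ j, 1 ≤ Q j)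
    (hm0 : 3 * L 0 ≤ r 0) (hL : ∀ j, L (j + 1) = (Q j + L j) ^ 2 - Q j ^ 2) (hL0 : 1 ≤ L 0)
    (hr : ∀ j, r (j + 1) = r j ^ 2)
    (hG : ∀ j (s t : ℝ), G (j + 1) s t = (((Q j : ℕ) : ℝ) ^ t + G j s t) ^ 2 - (((Q j : ℕ) : ℝ) ^ t) ^ 2)
    (hread : ∀ j (s t : ℝ), (∀ y : ℝ, 0 ≤ y → s + y * t ≤ omegaRect K 1 y 1) → G j s t ≤ r j)
    (hM : ∀ j, M (j + 1) = 2 * ((L j : ℝ) + Q j) * M j)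
    (hN : ∀ j, N (j + 1) = 2 * ((L j : ℝ) + Q j) * N j + 2 * (Q j : ℝ) * L j * Real.log (Q j))
    (hM0 : 0 < M 0) (hN0 : N 0 ≤ (r 0 : ℝ) * Real.log (r 0))
    (hI0 : ∀ s t : ℝ, (L 0 : ℝ) * Real.exp (((s - 1) * M 0 - (1 - t) * N 0) / L 0) ≤ G 0 s t)
    {θ : ℝ} (hθ : θ < Real.logb 2 ((4 : ℝ) / 3) / (1 - Real.logb 2 ((4 : ℝ) / 3))) :
    ∃ δ C : ℝ, θ < δ ∧ ∀ k : ℕ, 1 ≤ k →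
      omegaRect K 1 k 1 - (k + 1) ≤ C * (k : ℝ) ^ (-δ) := by
  obtain ⟨C, hC, hV⟩ := virtualPowerBound_of_momentChain K r Q L G M N hsum hQ1 hm0 hL hL0 hr hG
    hread hM hN hM0 hN0 hI0
  obtain ⟨hκ0, hκ1⟩ := improvableKappa_pos_lt_one
  refine ⟨_, (1 - Real.logb 2 ((4 : ℝ) / 3)) * (C * Real.logb 2 ((4 : ℝ) / 3) ^
    Real.logb 2 ((4 : ℝ) / 3)) ^ (1 / (1 - Real.logb 2 ((4 : ℝ) / 3))), hθ, fun k hk => ?_⟩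
  have hkpos : (0 : ℝ) < k := by exact_mod_cast hk
  exact FarEdgeDescentVirtualPoint.excess_le_const_mul_rpow_of_virtualPowerBound K hC hκ0 hκ1 hV hkpos

end Chain

end Summit.MatrixMultiplication.MatrixMultiplication.Theorems.FarEdgeDescentMomentReadout

end
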